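import Mathlib
import Summits.Ventures.LatticeQCDFlow.Scoring.CalibrationTruths
import Summits.Ventures.LatticeQCDFlow.Scoring.LagProductCovariance
import Summits.Ventures.LatticeQCDFlow.Scoring.FejerPairSums
import HarnessLib

/-!
# Bartlett's formula: `N · cov[Γ̂_N(s), Γ̂_N(t)] → Σ_m [c(m)c(m+t−s) + c(m+t)c(m−s)] = K(t−s) + K(t+s)`, the autocovariance-of-the-autocovariance `K`, and `Σ_u K(u) = (Σ_m c(m))²`

HONEST FRAMING: exact (Metropolis-corrected) sampling algorithms for lattice gauge theory;
figures of merit are autocorrelation/cost numbers at stated couplings and volumes; no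
continuum-physics claim.

Venture `LatticeQCDFlow` (cell pub-lqcd), sub-topic `Scoring`; FANOUT row 16 (`su2-base`), GEN-6.
NEW WORK of the cell over Mathlib and this packet's `LagProductCovariance` (exact finite-`N`
covariance of the empirical autocovariances of a Wick family, `covariance_acovHat_of_stationary`)
and `FejerPairSums` (`(1/N) Σ_{i,j<N} g(j−i) → Σ_ℤ g`).  Nothing is cited as a fact.  Printed
counterparts, NAMED ONLY: Bartlett 1946; Priestley 1981 §5.3.3; Broersen 2006 eq. (3.35) (held:
`cov[r̂(s), r̂(s+v)] ≈ (σ⁴/N) Σ_m [ρ(m)ρ(m+v) + ρ(m+s+v)ρ(m−s)]`); Anderson 1971 §8.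

Third file of the ERROR-OF-THE-ERROR packet.  With a stationary covariance `c : ℤ → ℝ` (even,
summable):

* `evenExt ρ` — the even extension to `ℤ` of the tree's `ℕ`-indexed autocorrelation functions
  (`CalibrationTruths.tauInt ρ = ½ + Σ_{t≥1} ρ t`); `summable_evenExt`, **`tsum_evenExt`**:
  `Σ_{m∈ℤ} ρ̄(m) = 2 τ_int(ρ)` when `ρ 0 = 1`.
* `acfConv c u = K(u) = Σ_{m∈ℤ} c(m) c(m+u)` — the autocovariance OF the covariance function;
  `summable_mul_shift` (each `K(u)` converges), `acfConv_neg` (`K(−u) = K(u)`, by translation —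
  no evenness needed), `summable_acfConv` and **`tsum_acfConv`**: `Σ_{u∈ℤ} K(u) = (Σ_{m∈ℤ} c(m))²`
  (Fubini on `ℤ × ℤ` after the shear `(u, m) ↦ (m, m+u)`); `acfConv_nonneg` for `c ≥ 0`;
  `two_mul_le_acfConv` (`K(u) ≥ 2 c(0) c(u)` for `c ≥ 0`, `u ≠ 0`).
* `acfConv_const_mul` (`K_{a c} = a² K_c`); `bartlettKernel c s t = B(s,t) = K(t − s) + K(t + s)`
  (`_comm`, `_const_mul`, `_nonneg`); `summable_bartlettSummand`, **`tsum_bartlettSummand`** —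
  `Σ_{m∈ℤ} g_{s,t}(m) = B(s,t)` (the second, 'exchange' term reindexed by `m ↦ m − t` is
  `K(−(t+s))`; evenness of `c` is never used).
* **`IsWickFamily.tendsto_covariance_acovHat`** — BARTLETT'S FORMULA for a stationary Wick family
  with summable covariance: `N · cov[Γ̂_N(s), Γ̂_N(t)] → Σ_m g_{s,t}(m) = B(s,t)` as
  `N → ∞` (exact finite-`N` identity of `LagProductCovariance` + the Fejér limit; NO moment
  condition); `tendsto_variance_acovHat` (`s = t`: `N · Var[Γ̂_N(t)] → K(0) + K(2t)`);
  `abs_covariance_acovHat_sub_le` — with a first moment the error is `≤ M₁/N²`·`N`… i.e.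
  `|N cov − B(s,t)| ≤ M₁(s,t)/N`.

NOT CLAIMED: non-Gaussian data (fourth cumulant term), mean subtraction, the `1/(N−t)` convention,
a CLT for `Γ̂_N`.
-/

noncomputable section

open MeasureTheory ProbabilityTheory Finset Filter Topology

namespace Summit.Ventures.LatticeQCDFlow.Scoring

/-! ## Even extension of an `ℕ`-indexed autocorrelation function -/

/-- The even extension `ρ̄(m) = ρ(|m|)` of an `ℕ`-indexed (auto)covariance function to `ℤ`. [ours] -/
def evenExt (ρ : ℕ → ℝ) (m : ℤ) : ℝ := ρ m.natAbs

/-- `ρ̄(n) = ρ(n)` on naturals. -/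
@[simp] theorem evenExt_natCast (ρ : ℕ → ℝ) (n : ℕ) : evenExt ρ n = ρ n := by
  simp [evenExt]

/-- `ρ̄(−m) = ρ̄(m)`. -/
@[simp] theorem evenExt_neg (ρ : ℕ → ℝ) (m : ℤ) : evenExt ρ (-m) = evenExt ρ m := by
  simp [evenExt]

/-- `ρ̄(0) = ρ 0`. -/
@[simp] theorem evenExt_zero (ρ : ℕ → ℝ) : evenExt ρ 0 = ρ 0 := by
  simp [evenExt]

/-- The even extension of a summable `ρ` is summable over `ℤ`. -/
theorem summable_evenExt {ρ : ℕ → ℝ} (hρ : Summable ρ) : Summable (evenExt ρ) := by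
  refine Summable.of_nat_of_neg ?_ ?_
  · simpa using hρ
  · simpa using hρ

/-- **`Σ_{m∈ℤ} ρ̄(m) = 2 τ_int(ρ)`** for a summable normalised autocorrelation function (`ρ 0 = 1`,
`τ_int = ½ + Σ_{t≥1} ρ t`, `CalibrationTruths.tauInt`). -/
theorem tsum_evenExt {ρ : ℕ → ℝ} (hρ : Summable ρ) (h0 : ρ 0 = 1) :
    ∑' m, evenExt ρ m = 2 * tauInt ρ := by
  rw [tsum_int_eq_zero_add_tsum_nat (summable_evenExt hρ), tauInt]
  have h1 : ∀ t : ℕ, evenExt ρ ((t : ℤ) + 1) + evenExt ρ (-((t : ℤ) + 1)) = 2 * ρ (t + 1) := by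
    intro t
    have : ((t : ℤ) + 1) = ((t + 1 : ℕ) : ℤ) := by push_cast; ring
    rw [this, evenExt_neg, evenExt_natCast]
    ring
  simp_rw [h1]
  rw [tsum_mul_left, evenExt_zero, h0]
  ring

/-! ## The autocovariance of the covariance function: `K(u) = Σ_m c(m) c(m+u)` -/

/-- Every term of a summable real sequence is bounded by the sum of absolute values. -/
theorem abs_le_tsum_abs {c : ℤ → ℝ} (hc : Summable c) (k : ℤ) : |c k| ≤ ∑' m, |c m| :=
  hc.abs.le_tsum k fun _ _ => abs_nonneg _

/-- The shifted products `m ↦ c(m) c(m+u)` are summable. -/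
theorem summable_mul_shift {c : ℤ → ℝ} (hc : Summable c) (u : ℤ) :
    Summable fun m => c m * c (m + u) := by
  refine Summable.of_norm_bounded (hc.abs.mul_right (∑' m, |c m|)) fun m => ?_
  rw [Real.norm_eq_abs, abs_mul]
  exact mul_le_mul_of_nonneg_left (abs_le_tsum_abs hc _) (abs_nonneg _)

/-- `K(u) = Σ_{m∈ℤ} c(m) c(m+u)`: the autocovariance OF the covariance function (the building block
of Bartlett's formula). [ours] -/
def acfConv (c : ℤ → ℝ) (u : ℤ) : ℝ := ∑' m, c m * c (m + u)

/-- Unfolding lemma for `acfConv`. -/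
theorem acfConv_def (c : ℤ → ℝ) (u : ℤ) : acfConv c u = ∑' m, c m * c (m + u) := rfl

/-- `K(−u) = K(u)` (translate the summation index by `u`; no evenness of `c` is needed). -/
theorem acfConv_neg (c : ℤ → ℝ) (u : ℤ) : acfConv c (-u) = acfConv c u := by
  unfold acfConv
  rw [← (Equiv.addRight u).tsum_eq]
  refine tsum_congr fun m => ?_
  simp only [Equiv.coe_addRight]
  rw [mul_comm]
  congr 2
  ring

/-- `K(0) = Σ_m c(m)²`. -/
theorem acfConv_zero (c : ℤ → ℝ) : acfConv c 0 = ∑' m, c m ^ 2 := by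
  unfold acfConv
  refine tsum_congr fun m => ?_
  rw [add_zero, sq]

/-- `K(u) ≥ 0` termwise when `c ≥ 0`. -/
theorem acfConv_nonneg {c : ℤ → ℝ} (hc0 : ∀ m, 0 ≤ c m) (u : ℤ) : 0 ≤ acfConv c u :=
  tsum_nonneg fun m => mul_nonneg (hc0 m) (hc0 _)

/-- For `c ≥ 0` summable and `u ≠ 0`: `K(u) ≥ 2 c(0) c(u)`… precisely `c 0 · c u + c (−u) · c 0 ≤ K(u)`
(the terms `m = 0` and `m = −u`). -/
theorem mul_add_mul_le_acfConv {c : ℤ → ℝ} (hc : Summable c) (hc0 : ∀ m, 0 ≤ c m) {u : ℤ}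
    (hu : u ≠ 0) : c 0 * c u + c (-u) * c 0 ≤ acfConv c u := by
  unfold acfConv
  have hs := summable_mul_shift hc u
  have h2 : ∑ m ∈ ({0, -u} : Finset ℤ), c m * c (m + u) = c 0 * c u + c (-u) * c 0 := by
    rw [sum_pair (by rw [ne_comm, neg_ne_zero]; exact hu)]
    simp
  rw [← h2]
  exact hs.sum_le_tsum _ fun m _ => mul_nonneg (hc0 m) (hc0 _)

/-- The shear `(u, m) ↦ (m, m + u)` of `ℤ × ℤ`. -/
def shearEquiv : ℤ × ℤ ≃ ℤ × ℤ where
  toFun p := (p.2, p.2 + p.1)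
  invFun q := (q.2 - q.1, q.1)
  left_inv p := by simp
  right_inv q := by simp

/-- The family `(u, m) ↦ c(m) c(m+u)` is summable on `ℤ × ℤ` (it is the shear of `c ⊗ c`). -/
theorem summable_mul_shift_prod {c : ℤ → ℝ} (hc : Summable c) :
    Summable fun p : ℤ × ℤ => c p.2 * c (p.2 + p.1) := by
  have h := summable_mul_of_summable_norm hc.norm hc.norm
  exact (shearEquiv.summable_iff (f := fun q : ℤ × ℤ => c q.1 * c q.2)).mpr h

/-- `K` is summable over `ℤ`. -/
theorem summable_acfConv {c : ℤ → ℝ} (hc : Summable c) : Summable (acfConv c) :=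
  (summable_mul_shift_prod hc).prod

/-- **`Σ_{u∈ℤ} K(u) = (Σ_{m∈ℤ} c(m))²`** (Fubini after the shear). -/
theorem tsum_acfConv {c : ℤ → ℝ} (hc : Summable c) :
    ∑' u, acfConv c u = (∑' m, c m) ^ 2 := by
  have h := summable_mul_shift_prod hc
  rw [sq, tsum_mul_tsum_of_summable_norm hc.norm hc.norm,
    ← shearEquiv.tsum_eq (f := fun q : ℤ × ℤ => c q.1 * c q.2)]
  simp only [shearEquiv, Equiv.coe_fn_mk]
  rw [h.tsum_prod]
  rfl

/-- `|K(u)| ≤ (Σ_m |c m|)²`. -/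
theorem abs_acfConv_le {c : ℤ → ℝ} (hc : Summable c) (u : ℤ) :
    |acfConv c u| ≤ (∑' m, |c m|) ^ 2 := by
  unfold acfConv
  have hs := summable_mul_shift hc u
  calc |∑' m, c m * c (m + u)| ≤ ∑' m, |c m * c (m + u)| := by
        have := norm_tsum_le_tsum_norm hs.norm
        simpa only [Real.norm_eq_abs] using this
    _ ≤ ∑' m, |c m| * ∑' k, |c k| := by
        refine Summable.tsum_le_tsum (fun m => ?_) hs.abs (hc.abs.mul_right _)
        rw [abs_mul]
        exact mul_le_mul_of_nonneg_left (abs_le_tsum_abs hc _) (abs_nonneg _)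
    _ = (∑' m, |c m|) ^ 2 := by rw [tsum_mul_right, sq]

/-- Scaling: `K_{a·c}(u) = a² K_c(u)` (so `K_{σ²ρ} = σ⁴ K_ρ`: Bartlett's `σ⁴` prefactor). -/
theorem acfConv_const_mul (a : ℝ) (c : ℤ → ℝ) (u : ℤ) :
    acfConv (fun m => a * c m) u = a ^ 2 * acfConv c u := by
  unfold acfConv
  rw [← tsum_mul_left]
  refine tsum_congr fun m => ?_
  ring

/-! ## Bartlett's kernel `Σ_m g_{s,t}(m) = K(t−s) + K(t+s)` -/

/-- BARTLETT'S KERNEL at lags `(s, t)`: `B(s,t) = K(t − s) + K(t + s)`, the `N → ∞` limit of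
`N · cov[Γ̂_N(s), Γ̂_N(t)]` (`tendsto_covariance_acovHat'`). [ours] -/
def bartlettKernel (c : ℤ → ℝ) (s t : ℕ) : ℝ := acfConv c ((t : ℤ) - s) + acfConv c ((t : ℤ) + s)

/-- Unfolding lemma for `bartlettKernel`. -/
theorem bartlettKernel_def (c : ℤ → ℝ) (s t : ℕ) :
    bartlettKernel c s t = acfConv c ((t : ℤ) - s) + acfConv c ((t : ℤ) + s) := rfl

/-- `B(s,t) = B(t,s)`. -/
theorem bartlettKernel_comm (c : ℤ → ℝ) (s t : ℕ) : bartlettKernel c s t = bartlettKernel c t s := by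
  simp only [bartlettKernel]
  rw [← acfConv_neg c ((s : ℤ) - t), neg_sub, add_comm (t : ℤ) s]

/-- Scaling: `B_{a·c} = a² B_c`. -/
theorem bartlettKernel_const_mul (a : ℝ) (c : ℤ → ℝ) (s t : ℕ) :
    bartlettKernel (fun m => a * c m) s t = a ^ 2 * bartlettKernel c s t := by
  simp only [bartlettKernel, acfConv_const_mul]
  ring

/-- `B ≥ 0` when `c ≥ 0`. -/
theorem bartlettKernel_nonneg {c : ℤ → ℝ} (hc0 : ∀ m, 0 ≤ c m) (s t : ℕ) :
    0 ≤ bartlettKernel c s t :=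
  add_nonneg (acfConv_nonneg hc0 _) (acfConv_nonneg hc0 _)


/-- Bartlett's summand is summable in `m`. -/
theorem summable_bartlettSummand {c : ℤ → ℝ} (hc : Summable c) (s t : ℕ) :
    Summable (bartlettSummand c s t) := by
  have h1 : Summable fun m => c m * c (m + ((t : ℤ) - s)) := summable_mul_shift hc _
  have h2 : Summable fun m => c (m + t) * c (m + t + (-((t : ℤ) + s))) :=
    (Equiv.addRight (t : ℤ)).summable_iff.mpr (summable_mul_shift hc (-((t : ℤ) + s)))
  refine (h1.add h2).congr fun m => ?_
  simp only [bartlettSummand]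
  congr 2 <;> ring_nf

/-- **Bartlett's kernel**: for a summable `c`,
`Σ_{m∈ℤ} [c(m)c(m+t−s) + c(m+t)c(m−s)] = K(t − s) + K(t + s)` (the exchange term reindexed by
`m ↦ m − t` is `K(−(t+s)) = K(t+s)`; no evenness is used). -/
theorem tsum_bartlettSummand {c : ℤ → ℝ} (hc : Summable c) (s t : ℕ) :
    ∑' m, bartlettSummand c s t m = bartlettKernel c s t := by
  rw [bartlettKernel]
  have h1 : Summable fun m => c m * c (m + ((t : ℤ) - s)) := summable_mul_shift hc _
  have h2 : Summable fun m => c (m + t) * c (m - s) := by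
    have := (Equiv.addRight (t : ℤ)).summable_iff.mpr (summable_mul_shift hc (-((t : ℤ) + s)))
    refine this.congr fun m => ?_
    simp only [Function.comp_apply, Equiv.coe_addRight]
    congr 2
    ring
  have hsplit : ∀ m, bartlettSummand c s t m
      = c m * c (m + ((t : ℤ) - s)) + c (m + t) * c (m - s) := by
    intro m
    simp only [bartlettSummand]
    congr 2
    ring
  simp_rw [hsplit]
  rw [h1.tsum_add h2]
  congr 1
  -- the exchange term: `Σ_m c(m+t) c(m−s) = K(−(t+s)) = K(t+s)`
  calc ∑' m, c (m + t) * c (m - s)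
      = ∑' m, (fun n : ℤ => c n * c (n + -((t : ℤ) + s))) (Equiv.addRight (t : ℤ) m) := by
        refine tsum_congr fun m => ?_
        simp only [Equiv.coe_addRight]
        congr 2
        ring
    _ = ∑' n, c n * c (n + -((t : ℤ) + s)) :=
        (Equiv.addRight (t : ℤ)).tsum_eq (fun n => c n * c (n + -((t : ℤ) + s)))
    _ = acfConv c (-((t : ℤ) + s)) := rfl
    _ = acfConv c ((t : ℤ) + s) := acfConv_neg c _

/-! ## Bartlett's formula for a stationary Wick family -/

namespace IsWickFamily

variable {Ω : Type*} {mΩ : MeasurableSpace Ω} {μ : Measure Ω} [IsProbabilityMeasure μ]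
variable {X : ℕ → Ω → ℝ} {C : ℕ → ℕ → ℝ} {c : ℤ → ℝ}

/-- `N · (x / N²) = x / N` for every natural `N` (both sides vanish at `N = 0`). -/
theorem natCast_mul_div_sq (x : ℝ) (N : ℕ) : (N : ℝ) * (x / (N : ℝ) ^ 2) = x / N := by
  rcases eq_or_ne N 0 with rfl | hN
  · simp
  · have : (N : ℝ) ≠ 0 := Nat.cast_ne_zero.mpr hN
    field_simp

/-- **Bartlett's formula (Wick model, no moment condition).**  For a stationary Wick family with
summable covariance function `c`, `N · cov[Γ̂_N(s), Γ̂_N(t)] → Σ_{m∈ℤ} g_{s,t}(m)` as `N → ∞`. -/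
theorem tendsto_covariance_acovHat (h : IsWickFamily X C μ) (hC : ∀ i j, C i j = c ((j : ℤ) - i))
    (hc : Summable c) (s t : ℕ) :
    Tendsto (fun N : ℕ => (N : ℝ) * cov[acovHat X N s, acovHat X N t; μ]) atTop
      (𝓝 (∑' m, bartlettSummand c s t m)) := by
  have := tendsto_sum_sum_int_sub_div (summable_bartlettSummand hc s t)
  refine this.congr fun N => ?_
  rw [h.covariance_acovHat_of_stationary hC, natCast_mul_div_sq]

/-- The same with the limit in closed form `K(t − s) + K(t + s)`. -/
theorem tendsto_covariance_acovHat' (h : IsWickFamily X C μ) (hC : ∀ i j, C i j = c ((j : ℤ) - i))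
    (hc : Summable c) (s t : ℕ) :
    Tendsto (fun N : ℕ => (N : ℝ) * cov[acovHat X N s, acovHat X N t; μ]) atTop
      (𝓝 (bartlettKernel c s t)) := by
  rw [← tsum_bartlettSummand hc s t]
  exact h.tendsto_covariance_acovHat hC hc s t

/-- In particular `N · Var[Γ̂_N(t)] → K(0) + K(2t)` (Bartlett 1946: `Var r̂(k) ≈ (σ⁴/N) Σ_m [ρ(m)² +
ρ(m+k)ρ(m−k)]`). -/
theorem tendsto_variance_acovHat (h : IsWickFamily X C μ) (hC : ∀ i j, C i j = c ((j : ℤ) - i))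
    (hc : Summable c) (t : ℕ) :
    Tendsto (fun N : ℕ => (N : ℝ) * Var[acovHat X N t; μ]) atTop
      (𝓝 (acfConv c 0 + acfConv c (2 * (t : ℤ)))) := by
  have := h.tendsto_covariance_acovHat' hC hc t t
  simp only [bartlettKernel, sub_self] at this
  rw [show (2 : ℤ) * t = (t : ℤ) + t by ring]
  refine this.congr fun N => ?_
  rw [covariance_self (h.memLp_acovHat N t).aestronglyMeasurable.aemeasurable]

/-- **The rate.**  Under a first moment of Bartlett's summand,
`|N · cov[Γ̂_N(s), Γ̂_N(t)] − Σ_m g_{s,t}(m)| ≤ M₁(s,t)/N` for every `N ≥ 1`. -/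
theorem abs_covariance_acovHat_sub_le (h : IsWickFamily X C μ)
    (hC : ∀ i j, C i j = c ((j : ℤ) - i)) (hc : Summable c) (s t : ℕ)
    (hM : Summable fun k : ℕ => ((k : ℝ) + 1) *
      (|bartlettSummand c s t ((k : ℤ) + 1)| + |bartlettSummand c s t (-((k : ℤ) + 1))|))
    {N : ℕ} (hN : N ≠ 0) :
    |(N : ℝ) * cov[acovHat X N s, acovHat X N t; μ] - ∑' m, bartlettSummand c s t m|
      ≤ (∑' k : ℕ, ((k : ℝ) + 1) *
          (|bartlettSummand c s t ((k : ℤ) + 1)| + |bartlettSummand c s t (-((k : ℤ) + 1))|)) / N := by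
  rw [h.covariance_acovHat_of_stationary hC, natCast_mul_div_sq]
  exact abs_sum_sum_int_sub_div_sub_tsum_le (summable_bartlettSummand hc s t) hM hN

end IsWickFamily

end Summit.Ventures.LatticeQCDFlow.Scoring
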